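import Summits.ResolutionOfSingularities.ResolutionOfSingularities.Theorems.FrobeniusClosingPatchingRelPerfectCoreRungMaximalPowers
import Literature.AlgebraicGeometry.Resolution.BlowupChartRsop
import Literature.AlgebraicGeometry.Resolution.RegularBlowup
import Literature.AlgebraicGeometry.Resolution.AffineBlowupCartier
import Literature.AlgebraicGeometry.Resolution.AffineBlowupRegular
import Literature.AlgebraicGeometry.Resolution.BlowupsFlatBaseChange
import Literature.AlgebraicGeometry.Resolution.GenericFibreResolutionDatum
import Literature.AlgebraicGeometry.Resolution.RsopMonomialIdeals
import Literature.AlgebraicGeometry.Resolution.RegularSystemOfParameters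
import HarnessLib

/-!
# Crux `PatchingRelPerfect` (stmt-ResolutionOfSingularities-16161), chain w52 — CORE RUNG r1c,
# part 1 (charts): the ideal `I = 𝔪² + (z₁, …, z_m)` on the Rees charts of the point blow-up

[OURS · L1 W5.2 · rung] Chart-level half of rung r1c (the blow-up-form open core
`stub_atomDimFourBlowup` / `AtomDimFourBlowupAt p` of skeleton v5.1 restricted to the family
`I = 𝔪² + (z₁, …, z_m)`, `z` part of a regular system of parameters `x = (z, y)` of a regular local
`S`; assembled in `…CoreRungSquarePlusLinear.lean`).  Let `B = Bl_𝔪 Spec S = Proj S[𝔪t]` with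
Rees charts `D₊(x_i t) = Spec B_i`, `B_i = (S[𝔪t])_{(x_i t)}`, chart generators `e_j = x_j/x_i`.
PROVED here, for every regular local `S` of every dimension:

* affine regular-centre tools: `isRegular_subscheme_idealSheaf_of_quotient` (`V(𝔫~) ≅ Spec B/𝔫`
  is regular when `B/𝔫` is a regular ring), `isRegular_of_isBlowup_idealSheaf_of_quotient`
  (Liu 8.1.19 (a) on `Spec B`), `isRegular_of_isBlowup_idealSheaf_span_singleton_mul` (blowing up
  `(g)·𝔫`, `g` a non-zero-divisor: twist off the Cartier factor, Stacks 080B),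
  `isRegular_of_isBlowup_idealSheaf_span_singleton_of_isRegularRing`;
* the total transform of `I` on the charts: `map_chartBase_sqSup_castAdd` — on the chart of a
  killed direction `z_j`, `I · B_i = (z_j)` (the exceptional divisor); `map_chartBase_sqSup_natAdd` —
  on the chart of a tangent direction `y_k` of `Z = V(z)`, `I · B_i = y_k · (y_k, z₁/y_k, …, z_m/y_k)`,
  the exceptional parameter times the ideal of the REGULAR centre `ℙ(T_Z) ∩ D₊(y_k t)`
  (`B_i ⧸ (y_k, z/y_k) ≅ κ[T]`, de Jong's chart computation `isRegularRing_quot_chartIdeal`);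
* hence every blow-up of a chart along `I · B_i` is regular (`isRegular_of_isBlowup_chart`).

Nothing here is a statement of the manuscript under review.

## References

* The Stacks Project, Tags 080B, 0804, 0BIQ. [StacksProject]
* Q. Liu, *Algebraic Geometry and Arithmetic Curves*, OUP 2002, Thm. 8.1.19 (a). [Liu2002]
* A. J. de Jong, *Smoothness, semi-stability and alterations*, Publ. Math. IHÉS 83 (1996), 2.4.
  [DeJong1996]
* H. Matsumura, *Commutative Ring Theory*, CUP 1986, Thms. 14.2, 16.2, 19.3. [Matsumura1987]
-/

-- `Summit.<Summit>.<Sub>.Theorems` with `Sub = Summit` (single-conjunct summit, D-0017)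
set_option linter.dupNamespace false

noncomputable section

open CategoryTheory CategoryTheory.Limits AlgebraicGeometry Literature.AlgebraicGeometry.Resolution
open Summit.ResolutionOfSingularities.ResolutionOfSingularities.Theorems.PatchingRelPerfect.Negative
  (isBlowup_ne_bot_of_nonempty)

namespace Summit.ResolutionOfSingularities.ResolutionOfSingularities.Theorems

universe u

/-! ## Regular centres on affine schemes, and blowing up `(g) · 𝔫` -/

/-- **The closed subscheme `V(𝔫~) ⊆ Spec B` is regular when `B ⧸ 𝔫` is a regular ring**: it is
`Spec (B ⧸ 𝔫)` (same kernel as the closed immersion `Spec (B ⧸ 𝔫) → Spec B`). [folklore] -/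
theorem isRegular_subscheme_idealSheaf_of_quotient (B : Type u) [CommRing B] (𝔫 : Ideal B)
    [IsRegularRing (B ⧸ 𝔫)] : Scheme.IsRegular (affineBlowup.idealSheaf 𝔫).subscheme := by
  let j : Spec (.of (B ⧸ 𝔫)) ⟶ Spec (.of B) := Spec.map (CommRingCat.ofHom (Ideal.Quotient.mk 𝔫))
  haveI : IsClosedImmersion j := IsClosedImmersion.spec_of_surjective _ Ideal.Quotient.mk_surjective
  have hker : (affineBlowup.idealSheaf 𝔫).subschemeι.ker = j.ker := by
    rw [Scheme.IdealSheafData.ker_subschemeι, ker_specMap_quotient_mk]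
  haveI := IsClosedImmersion.isIso_lift _ j hker
  have hreg : Scheme.IsRegular (Spec (.of (B ⧸ 𝔫))) := by
    haveI : IsRegularRing (CommRingCat.of (B ⧸ 𝔫)) := inferInstanceAs (IsRegularRing (B ⧸ 𝔫))
    exact Scheme.isRegular_Spec _
  exact Scheme.IsRegular.of_isOpenImmersion (inv (IsClosedImmersion.lift _ j hker.le)) hreg

/-- **Blowing up `Spec B` along `𝔫~` gives a regular scheme** when `B` is a regular ring and
`B ⧸ 𝔫` is a regular ring (Liu, Thm. 8.1.19 (a), tree `IsBlowup.isRegular_of_isRegular_subscheme`).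
[cite: Liu2002, Thm. 8.1.19 (a)] -/
theorem isRegular_of_isBlowup_idealSheaf_of_quotient {B : Type u} [CommRing B] [IsRegularRing B]
    (𝔫 : Ideal B) [IsRegularRing (B ⧸ 𝔫)] {Y : Scheme.{u}} {ρ : Y ⟶ Spec (.of B)}
    (hρ : IsBlowup ρ (affineBlowup.idealSheaf 𝔫)) : Scheme.IsRegular Y := by
  haveI : IsNoetherianRing (CommRingCat.of B) := (inferInstance : IsNoetherianRing B)
  haveI : IsRegularRing (CommRingCat.of B) := inferInstanceAs (IsRegularRing B)
  exact hρ.isRegular_of_isRegular_subscheme (Scheme.isRegular_Spec _)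
    (isRegular_subscheme_idealSheaf_of_quotient B 𝔫)

/-- **Blowing up `Spec B` along `(g) · 𝔫` gives a regular scheme** when `B` is a regular ring,
`g` is a non-zero-divisor and `B ⧸ 𝔫` is a regular ring: twisting the centre `𝔫~` by the
effective Cartier divisor `(g)~` does not change the blowing up
(`IsBlowup.mul_of_isEffectiveCartier`), which is regular by Liu 8.1.19 (a).
[cite: StacksProject, Tag 080B (proof)] [cite: Liu2002, Thm. 8.1.19 (a)] -/
theorem isRegular_of_isBlowup_idealSheaf_span_singleton_mul {B : Type u} [CommRing B]
    [IsRegularRing B] {g : B} (hg : g ∈ nonZeroDivisors B) (𝔫 : Ideal B)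
    [IsRegularRing (B ⧸ 𝔫)] {Y : Scheme.{u}} {ρ : Y ⟶ Spec (.of B)}
    (hρ : IsBlowup ρ (affineBlowup.idealSheaf (Ideal.span {g} * 𝔫))) : Scheme.IsRegular Y := by
  obtain ⟨Y', ρ', h'⟩ := exists_isBlowup (Spec (.of B)) (affineBlowup.idealSheaf 𝔫)
  have hreg : Scheme.IsRegular Y' := isRegular_of_isBlowup_idealSheaf_of_quotient 𝔫 h'
  have h'' : IsBlowup ρ' (affineBlowup.idealSheaf (Ideal.span {g} * 𝔫)) := by
    rw [mul_comm, affineBlowup.idealSheaf_mul]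
    exact h'.mul_of_isEffectiveCartier (affineBlowup.isEffectiveCartier_idealSheaf_span_singleton hg)
  obtain ⟨e, -, -⟩ := hρ.unique h''
  exact SectionAscent.TraceIdeal.isRegular_of_iso e hreg

/-- **Blowing up `Spec B` along `(g)`, `g` a non-zero-divisor, gives a regular scheme** when `B`
is a regular ring: the blowing up is an isomorphism. [cite: GortzWedhorn2020, (13.19) p. 413] -/
theorem isRegular_of_isBlowup_idealSheaf_span_singleton_of_isRegularRing {B : Type u} [CommRing B]
    [IsRegularRing B] {g : B} (hg : g ∈ nonZeroDivisors B) {Y : Scheme.{u}}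
    {ρ : Y ⟶ Spec (.of B)} (hρ : IsBlowup ρ (affineBlowup.idealSheaf (Ideal.span {g}))) :
    Scheme.IsRegular Y := by
  haveI : IsIso ρ := hρ.isIso (affineBlowup.isEffectiveCartier_idealSheaf_span_singleton hg)
  haveI : IsRegularRing (CommRingCat.of B) := inferInstanceAs (IsRegularRing B)
  exact SectionAscent.TraceIdeal.isRegular_of_iso (asIso ρ) (Scheme.isRegular_Spec _)


/-! ## The point blow-up of a regular local ring: the ideal `𝔪² + (z)` on the Rees charts

`S` regular local with regular system of parameters `x = (z₁, …, z_m, y₁, …, y_e)`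
(`x ∘ Fin.castAdd e = z` the "killed" directions, `x ∘ Fin.natAdd m = y` the tangent directions
of the regular germ `Z = V(z)`), `M = (x) = 𝔪`, and the rung's ideal `I = M² + (z)`. -/

section Charts

variable {S : Type u} [CommRing S] {m e : ℕ} (x : Fin (m + e) → S)

local notation3 "M" => Ideal.span (Set.range x)
local notation3 "Isq" => Ideal.span (Set.range x) ^ 2 ⊔
  Ideal.span (Set.range fun j : Fin m => x (Fin.castAdd e j))

/-- **On the chart of a tangent direction `y_k`** the ideal `I = 𝔪² + (z)` becomes
`y_k · (y_k, z₁/y_k, …, z_m/y_k)`: the exceptional parameter times the ideal of the linear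
subspace `ℙ(T_Z) ⊆ E ≅ ℙ^{n-1}` of the exceptional divisor. [folklore] -/
theorem map_chartBase_sqSup_natAdd (k : Fin e) :
    (Isq).map (chartBase x (Fin.natAdd m k)) =
      Ideal.span {chartBase x (Fin.natAdd m k) (x (Fin.natAdd m k))} *
        Ideal.ofList (chartBase x (Fin.natAdd m k) (x (Fin.natAdd m k)) ::
          List.ofFn fun j : Fin m => chartGen x (Fin.natAdd m k) (Fin.castAdd e j)) := by
  set i : Fin (m + e) := Fin.natAdd m k with hi
  have hxi : x i ∈ M := Ideal.mem_span_range_self (f := x) (x := i)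
  have hgmem : chartBase x i (x i) ∈ Ideal.ofList (chartBase x i (x i) ::
      List.ofFn fun j : Fin m => chartGen x i (Fin.castAdd e j)) :=
    Ideal.subset_span (by simp)
  apply le_antisymm
  · rw [Ideal.map_sup, Ideal.map_pow, map_reesChartBase_eq (x i) hxi]
    refine sup_le ?_ ?_
    · rw [Ideal.span_singleton_pow, Ideal.span_singleton_le_iff_mem, pow_two]
      exact Ideal.mul_mem_mul (Ideal.mem_span_singleton_self _) hgmem
    · rw [Ideal.map_span, Ideal.span_le]
      rintro _ ⟨_, ⟨j, rfl⟩, rfl⟩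
      rw [SetLike.mem_coe, reesChartBase_apply_eq_mul_chartGen x i (Fin.castAdd e j)]
      exact Ideal.mul_mem_mul (Ideal.mem_span_singleton_self _) (Ideal.subset_span (by simp))
  · rw [Ideal.ofList, Ideal.span_mul_span', Ideal.span_le]
    rintro _ ⟨a, ha, t, ht, rfl⟩
    rw [Set.mem_singleton_iff] at ha
    subst ha
    simp only [Set.mem_setOf_eq, List.mem_cons, List.mem_ofFn] at ht
    show chartBase x i (x i) * t ∈ (Isq).map (chartBase x i)
    rcases ht with rfl | ⟨j, rfl⟩
    · -- `φ(x_i) * φ(x_i) = φ(x_i²)`, `x_i² ∈ 𝔪²`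
      have h2 : x i * x i ∈ M ^ 2 := by rw [pow_two]; exact Ideal.mul_mem_mul hxi hxi
      rw [← map_mul]
      exact Ideal.mem_map_of_mem _ (Ideal.mem_sup_left h2)
    · -- `φ(x_i) * e_j = φ(z_j)`
      rw [← reesChartBase_apply_eq_mul_chartGen x i (Fin.castAdd e j)]
      exact Ideal.mem_map_of_mem _ (Ideal.mem_sup_right (Ideal.subset_span ⟨j, rfl⟩))

/-- **On the chart of a killed direction `z_j`** the ideal `I = 𝔪² + (z)` becomes the
principal ideal `(z_j)` of the exceptional divisor. [folklore] -/
theorem map_chartBase_sqSup_castAdd (j : Fin m) :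
    (Isq).map (chartBase x (Fin.castAdd e j)) =
      Ideal.span {chartBase x (Fin.castAdd e j) (x (Fin.castAdd e j))} := by
  set i : Fin (m + e) := Fin.castAdd e j with hi
  have hxi : x i ∈ M := Ideal.mem_span_range_self (f := x) (x := i)
  apply le_antisymm
  · rw [Ideal.map_sup, Ideal.map_pow, map_reesChartBase_eq (x i) hxi]
    refine sup_le ?_ ?_
    · rw [Ideal.span_singleton_pow, Ideal.span_singleton_le_iff_mem, pow_two]
      exact Ideal.mul_mem_left _ _ (Ideal.mem_span_singleton_self _)
    · rw [Ideal.map_span, Ideal.span_le]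
      rintro _ ⟨_, ⟨j', rfl⟩, rfl⟩
      rw [SetLike.mem_coe, reesChartBase_apply_eq_mul_chartGen x i (Fin.castAdd e j')]
      exact Ideal.mul_mem_right _ _ (Ideal.mem_span_singleton_self _)
  · rw [Ideal.span_singleton_le_iff_mem]
    exact Ideal.mem_map_of_mem _ (Ideal.mem_sup_right (Ideal.subset_span ⟨j, rfl⟩))

end Charts


/-! ## Regularity of `Bl_{I·𝔪} Spec S`, chart by chart -/

section Regularity

variable {S : Type u} [CommRing S] [IsRegularLocalRing S] {m e : ℕ} (x : Fin (m + e) → S)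
  (hx : Ideal.span (Set.range x) = IsLocalRing.maximalIdeal S)
  (hd : (IsLocalRing.maximalIdeal S).spanFinrank = m + e)

local notation3 "M" => Ideal.span (Set.range x)
local notation3 "Isq" => Ideal.span (Set.range x) ^ 2 ⊔
  Ideal.span (Set.range fun j : Fin m => x (Fin.castAdd e j))

include hx in
/-- The residue field `S ⧸ (x) = S ⧸ 𝔪` is a regular ring. [folklore] -/
theorem isRegularRing_quotient_span_rsop : IsRegularRing (S ⧸ Ideal.span (Set.range x)) := by
  haveI : (Ideal.span (Set.range x)).IsMaximal := hx ▸ IsLocalRing.maximalIdeal.isMaximal S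
  letI := Ideal.Quotient.field (Ideal.span (Set.range x))
  infer_instance

include hx hd in
/-- **The Rees charts `(S[𝔪t])_{(x_i t)}` of the point blow-up of a regular local ring are regular
rings** (tree `isRegularRing_blowupChart`). [cite: Liu2002, Thm. 8.1.19 (a) (affine charts)] -/
theorem isRegularRing_chartRing_rsop (i : Fin (m + e)) : IsRegularRing (chartRing x i) := by
  haveI : IsRegularRing S := isRegularRing_of_isRegularLocalRing S
  haveI := isRegularRing_quotient_span_rsop x hx
  exact isRegularRing_blowupChart x i (isQuasiRegular_regularSystemOfParameters hd x hx)

include hx hd in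
/-- **On the chart of a tangent direction `y_k`, the centre `(y_k, z₁/y_k, …, z_m/y_k)` has regular
quotient**: `B ⧸ (y_k, z/y_k) ≅ κ[T_j : j a tangent direction, j ≠ k]`, a polynomial ring over the
residue field (tree `isRegularRing_quot_chartIdeal`, de Jong's chart computation).
[cite: StacksProject, Tag 0BIQ] -/
theorem isRegularRing_chartRing_quot_natAdd (k : Fin e) :
    IsRegularRing (chartRing x (Fin.natAdd m k) ⧸ Ideal.ofList
      (chartBase x (Fin.natAdd m k) (x (Fin.natAdd m k)) ::
        List.ofFn fun j : Fin m => chartGen x (Fin.natAdd m k) (Fin.castAdd e j))) := by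
  have hsurj : Function.Surjective (Fin.cast (Nat.add_zero (m + e))) :=
    (finCongr (Nat.add_zero (m + e))).surjective
  have hz' : Ideal.span (Set.range (Fin.append x Fin.elim0)) = IsLocalRing.maximalIdeal S := by
    rw [Fin.append_elim0, hsurj.range_comp]; exact hx
  have hd' : (IsLocalRing.maximalIdeal S).spanFinrank = (m + e) + 0 := hd
  have hne : ∀ j : Fin m, Fin.castAdd e j ≠ Fin.natAdd m k := by
    intro j h
    have h' := congrArg Fin.val h
    rw [Fin.val_castAdd, Fin.val_natAdd] at h'
    have := j.2
    omega
  have h := isRegularRing_quot_chartIdeal x (Fin.natAdd m k) Fin.elim0 hz' hd'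
    (chartBase x (Fin.natAdd m k)) (chartGen x (Fin.natAdd m k))
    (chartQuotEquiv x (Fin.natAdd m k) (isQuasiRegular_regularSystemOfParameters hd x hx))
    (chartQuotMap_C x (Fin.natAdd m k)) (chartQuotMap_X x (Fin.natAdd m k))
    (fun j : Fin m => (⟨Fin.castAdd e j, hne j⟩ : {j : Fin (m + e) // j ≠ Fin.natAdd m k}))
  have hEq : Ideal.ofList (chartBase x (Fin.natAdd m k) (x (Fin.natAdd m k)) ::
      ((List.ofFn fun j : Fin m => chartGen x (Fin.natAdd m k) (Fin.castAdd e j)) ++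
        List.ofFn fun j : Fin 0 => chartBase x (Fin.natAdd m k) (Fin.elim0 j))) =
      Ideal.ofList (chartBase x (Fin.natAdd m k) (x (Fin.natAdd m k)) ::
        List.ofFn fun j : Fin m => chartGen x (Fin.natAdd m k) (Fin.castAdd e j)) := by
    rw [List.ofFn_zero, List.append_nil]
  haveI := h
  exact IsRegularRing.of_ringEquiv (Ideal.quotEquivOfEq hEq)

include hx hd in
/-- **Chart of a tangent direction**: every blow-up of the chart `Spec (S[𝔪t])_{(y_k t)}` along
`I · B = y_k · (y_k, z/y_k)` is regular (twist off the exceptional factor, then Liu 8.1.19 (a) for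
the regular centre `ℙ(T_Z) ∩ chart`). [cite: Liu2002, Thm. 8.1.19 (a)] -/
theorem isRegular_of_isBlowup_chart_natAdd (k : Fin e) {Y : Scheme.{u}}
    {ρ : Y ⟶ Spec (.of (chartRing x (Fin.natAdd m k)))}
    (hρ : IsBlowup ρ (affineBlowup.idealSheaf ((Isq).map (chartBase x (Fin.natAdd m k))))) :
    Scheme.IsRegular Y := by
  rw [map_chartBase_sqSup_natAdd] at hρ
  haveI := isRegularRing_chartRing_rsop x hx hd (Fin.natAdd m k)
  haveI := isRegularRing_chartRing_quot_natAdd x hx hd k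
  exact isRegular_of_isBlowup_idealSheaf_span_singleton_mul
    (reesChartBase_mem_nonZeroDivisors (x (Fin.natAdd m k))
      (Ideal.mem_span_range_self (f := x) (x := Fin.natAdd m k))) _ hρ

include hx hd in
/-- **Chart of a killed direction**: every blow-up of the chart `Spec (S[𝔪t])_{(z_j t)}` along
`I · B = (z_j)` is regular (the blow-up is an isomorphism onto a regular chart).
[cite: Liu2002, Thm. 8.1.19 (a) (affine charts)] -/
theorem isRegular_of_isBlowup_chart_castAdd (j : Fin m) {Y : Scheme.{u}}
    {ρ : Y ⟶ Spec (.of (chartRing x (Fin.castAdd e j)))}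
    (hρ : IsBlowup ρ (affineBlowup.idealSheaf ((Isq).map (chartBase x (Fin.castAdd e j))))) :
    Scheme.IsRegular Y := by
  rw [map_chartBase_sqSup_castAdd] at hρ
  haveI := isRegularRing_chartRing_rsop x hx hd (Fin.castAdd e j)
  exact isRegular_of_isBlowup_idealSheaf_span_singleton_of_isRegularRing
    (reesChartBase_mem_nonZeroDivisors (x (Fin.castAdd e j))
      (Ideal.mem_span_range_self (f := x) (x := Fin.castAdd e j))) hρ

include hx hd in
/-- Both kinds of charts at once. [cite: Liu2002, Thm. 8.1.19 (a)] -/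
theorem isRegular_of_isBlowup_chart (i : Fin (m + e)) {Y : Scheme.{u}}
    {ρ : Y ⟶ Spec (.of (chartRing x i))}
    (hρ : IsBlowup ρ (affineBlowup.idealSheaf ((Isq).map (chartBase x i)))) :
    Scheme.IsRegular Y := by
  induction i using Fin.addCases with
  | left j => exact isRegular_of_isBlowup_chart_castAdd x hx hd j hρ
  | right k => exact isRegular_of_isBlowup_chart_natAdd x hx hd k hρ

end Regularity

end Summit.ResolutionOfSingularities.ResolutionOfSingularities.Theorems

end
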